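import Mathlib
import Summits.Ventures.PercRepro2.Defs
import Summits.Ventures.PercRepro2.CoinDefs
import Summits.Ventures.PercRepro2.CoinArcsOff
import Summits.Ventures.PercRepro2.CoinPendantDefs

/-!
# The pendant path `w → v → t` with arbitrary entries into `v`: the three levels (blind cell
PercRepro2, night-2; proofs/NIGHT2-DARC.md §12, corollary)

Two path coins `c₁ = {w → v}` and `c₂ = {v → t}` (`t ∈ T`), the only coins with an arc leaving `w`
or `v` (`OnlyPathCoins`); every other arc may enter `w` or `v`.  With `Z = {w, v} ∪ T` and
`D₀ = arcsOff arcs Z`, the configuration of the two path coins fixes the LEVEL: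
* level 0 (`c₂` closed): nothing on the path reaches `T`; `R_T = R^{D₀}_T`, the gate is `R_T`;
* level 1 (`c₂` open, `c₁` closed): `v → T` but `w ↛ T`; `R_T = R^{D₀}_{T ∪ {v}}`, the gate is `R_T`;
* level 2 (both open): `w → v → T`; `R_T = R^{D₀}_{T ∪ {v, w}}` and the gate is `R^{D₀}_{T ∪ {u, v, w}}`.
The three avoidance sets form a CHAIN — the situation of the chain lemma (`CoinChain.lean`).
This file proves the level identities (`avoid_level₀`, `avoid_level₁`, `avoid_level₂`,
`gate_level₂`, `gate_eq_avoid_of_level₀₁`) and the marker identity on `R_T` (`reach_iff_path`).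
-/

namespace Summit.Ventures.PercRepro2.Coin

section Path

variable {V : Type*} {E : Type*} [DecidableEq V]

/-- The two path coins are the only coins with an arc leaving `w` or `v`. -/
def OnlyPathCoins (arcs : E → Finset (V × V)) (w v : V) (c₁ c₂ : E) : Prop :=
  ∀ e, (∃ xy ∈ arcs e, xy.1 = w ∨ xy.1 = v) → e = c₁ ∨ e = c₂

/-- Along the path coins, a path from `v` either stays at `v` or steps to `t` through `c₂`. -/
lemma reach_arcsOn_from_v {arcs : E → Finset (V × V)} {w v t : V} {T : Finset V} {c₁ c₂ : E}
    (hc₁ : arcs c₁ = {(w, v)}) (hc₂ : arcs c₂ = {(v, t)}) (hwv : w ≠ v) (htT : t ∈ T)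
    (hwT : w ∉ T) (hvT : v ∉ T) (hpath : OnlyPathCoins arcs w v c₁ c₂) {ω : Config E} {y : V}
    (h : Reach (arcsOn arcs {w, v}) ω v y) : y = v ∨ (ω c₂ = true ∧ y = t) := by
  induction h with
  | refl => exact Or.inl rfl
  | @tail y' y _ hstep ih =>
    obtain ⟨e, he, hxy⟩ := hstep
    simp only [arcsOn, Finset.mem_filter, Finset.mem_insert, Finset.mem_singleton] at hxy
    rcases ih with hy' | ⟨_, hy'⟩
    · -- the arc leaves `v`: it is the arc of `c₂`
      rw [hy'] at hxy
      rcases hpath e ⟨(v, y), hxy.1, Or.inr rfl⟩ with rfl | rfl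
      · rw [hc₁] at hxy
        simp only [Finset.mem_singleton, Prod.mk.injEq] at hxy
        exact absurd hxy.1.1.symm hwv
      · rw [hc₂] at hxy
        simp only [Finset.mem_singleton, Prod.mk.injEq] at hxy
        exact Or.inr ⟨he, hxy.1.2⟩
    · -- the arc leaves `t ∈ T`: impossible along the path coins (its tail would be `w` or `v`)
      rw [hy'] at hxy
      rcases hxy.2 with h | h
      · exact absurd (h ▸ htT) hwT
      · exact absurd (h ▸ htT) hvT

/-- Along the path coins, a path from `w` stays at `w`, steps to `v` through `c₁`, or reaches `t`
through `c₁` and `c₂`. -/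
lemma reach_arcsOn_from_w {arcs : E → Finset (V × V)} {w v t : V} {T : Finset V} {c₁ c₂ : E}
    (hc₁ : arcs c₁ = {(w, v)}) (hc₂ : arcs c₂ = {(v, t)}) (hwv : w ≠ v) (htT : t ∈ T)
    (hwT : w ∉ T) (hvT : v ∉ T) (hpath : OnlyPathCoins arcs w v c₁ c₂) {ω : Config E} {y : V}
    (h : Reach (arcsOn arcs {w, v}) ω w y) :
    y = w ∨ (ω c₁ = true ∧ y = v) ∨ (ω c₁ = true ∧ ω c₂ = true ∧ y = t) := by
  induction h with
  | refl => exact Or.inl rfl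
  | @tail y' y _ hstep ih =>
    obtain ⟨e, he, hxy⟩ := hstep
    simp only [arcsOn, Finset.mem_filter, Finset.mem_insert, Finset.mem_singleton] at hxy
    rcases ih with hy' | ⟨h₁, hy'⟩ | ⟨_, _, hy'⟩
    · rw [hy'] at hxy
      rcases hpath e ⟨(w, y), hxy.1, Or.inl rfl⟩ with rfl | rfl
      · rw [hc₁] at hxy
        simp only [Finset.mem_singleton, Prod.mk.injEq] at hxy
        exact Or.inr (Or.inl ⟨he, hxy.1.2⟩)
      · rw [hc₂] at hxy
        simp only [Finset.mem_singleton, Prod.mk.injEq] at hxy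
        exact absurd hxy.1.1 hwv
    · rw [hy'] at hxy
      rcases hpath e ⟨(v, y), hxy.1, Or.inr rfl⟩ with rfl | rfl
      · rw [hc₁] at hxy
        simp only [Finset.mem_singleton, Prod.mk.injEq] at hxy
        exact absurd hxy.1.1.symm hwv
      · rw [hc₂] at hxy
        simp only [Finset.mem_singleton, Prod.mk.injEq] at hxy
        exact Or.inr (Or.inr ⟨h₁, he, hxy.1.2⟩)
    · rw [hy'] at hxy
      rcases hxy.2 with h | h
      · exact absurd (h ▸ htT) hwT
      · exact absurd (h ▸ htT) hvT

/-- `ClosedOut` holds for the path. -/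
lemma closedOut_path {arcs : E → Finset (V × V)} {w v t : V} {T : Finset V} {c₁ c₂ : E}
    (hc₁ : arcs c₁ = {(w, v)}) (hc₂ : arcs c₂ = {(v, t)}) (htT : t ∈ T)
    (hpath : OnlyPathCoins arcs w v c₁ c₂) : ClosedOut arcs {w, v} T := by
  intro e xy hxy hx
  simp only [Finset.mem_insert, Finset.mem_singleton] at hx
  rcases hpath e ⟨xy, hxy, hx⟩ with rfl | rfl
  · rw [hc₁] at hxy; simp only [Finset.mem_singleton] at hxy; subst hxy; simp
  · rw [hc₂] at hxy; simp only [Finset.mem_singleton] at hxy; subst hxy; simp [htT]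

/-- `v` reaches `T` iff `c₂` is open. -/
lemma bwd_v_iff {arcs : E → Finset (V × V)} {w v t : V} {T : Finset V} {c₁ c₂ : E}
    (hc₁ : arcs c₁ = {(w, v)}) (hc₂ : arcs c₂ = {(v, t)}) (hwv : w ≠ v) (htT : t ∈ T)
    (hwT : w ∉ T) (hvT : v ∉ T) (hpath : OnlyPathCoins arcs w v c₁ c₂) (ω : Config E) :
    ω ∈ bwdEvent arcs v T ↔ ω c₂ = true := by
  have hclosed := closedOut_path hc₁ hc₂ htT hpath
  have hv : v ∈ ({w, v} : Finset V) := by simp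
  rw [bwdEvent_iff_arcsOn hclosed hv]
  constructor
  · rintro ⟨t', ht', hr⟩
    rcases reach_arcsOn_from_v hc₁ hc₂ hwv htT hwT hvT hpath hr with rfl | ⟨h, _⟩
    · exact absurd ht' hvT
    · exact h
  · intro h
    refine ⟨t, htT, reach_of_openArc ⟨c₂, h, ?_⟩⟩
    simp only [arcsOn, Finset.mem_filter, hc₂, Finset.mem_singleton, Finset.mem_insert, true_and]
    simp

/-- `w` reaches `T` iff both path coins are open. -/
lemma bwd_w_iff {arcs : E → Finset (V × V)} {w v t : V} {T : Finset V} {c₁ c₂ : E}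
    (hc₁ : arcs c₁ = {(w, v)}) (hc₂ : arcs c₂ = {(v, t)}) (hwv : w ≠ v) (htT : t ∈ T)
    (hwT : w ∉ T) (hvT : v ∉ T) (hpath : OnlyPathCoins arcs w v c₁ c₂) (ω : Config E) :
    ω ∈ bwdEvent arcs w T ↔ (ω c₁ = true ∧ ω c₂ = true) := by
  have hclosed := closedOut_path hc₁ hc₂ htT hpath
  have hw : w ∈ ({w, v} : Finset V) := by simp
  rw [bwdEvent_iff_arcsOn hclosed hw]
  constructor
  · rintro ⟨t', ht', hr⟩
    rcases reach_arcsOn_from_w hc₁ hc₂ hwv htT hwT hvT hpath hr with rfl | ⟨_, rfl⟩ | ⟨h₁, h₂, _⟩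
    · exact absurd ht' hwT
    · exact absurd ht' hvT
    · exact ⟨h₁, h₂⟩
  · rintro ⟨h₁, h₂⟩
    have s₁ : OpenArc (arcsOn arcs {w, v}) ω w v := ⟨c₁, h₁, by
      simp only [arcsOn, Finset.mem_filter, hc₁, Finset.mem_singleton, Finset.mem_insert, true_and]
      simp⟩
    have s₂ : OpenArc (arcsOn arcs {w, v}) ω v t := ⟨c₂, h₂, by
      simp only [arcsOn, Finset.mem_filter, hc₂, Finset.mem_singleton, Finset.mem_insert, true_and]
      simp⟩
    exact ⟨t, htT, reach_trans (reach_of_openArc s₁) (reach_of_openArc s₂)⟩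

/-- From `z ∈ {w, v}` the original map reaches a vertex outside `{w, v} ∪ T` only through `T`. -/
lemma reach_from_path_into_T {arcs : E → Finset (V × V)} {w v t : V} {T : Finset V} {c₁ c₂ : E}
    (hc₁ : arcs c₁ = {(w, v)}) (hc₂ : arcs c₂ = {(v, t)}) (htT : t ∈ T)
    (hpath : OnlyPathCoins arcs w v c₁ c₂) {ω : Config E} {z y : V} (hz : z ∈ ({w, v} : Finset V))
    (hy : y ∉ ({w, v} : Finset V) ∪ T) (h : Reach arcs ω z y) : ∃ t' ∈ T, Reach arcs ω z t' := by
  have hclosed := closedOut_path hc₁ hc₂ htT hpath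
  rcases reach_from_pendant hclosed hz h with h₀ | ⟨t', ht', h₀⟩
  · exact absurd (reach_arcsOn_stay hclosed hz h₀) hy
  · exact ⟨t', ht', reach_of_reach_arcsOn h₀⟩

/-- **Marker identity on `R_T`**: for `a ∉ {w, v} ∪ T`, `s ⇝ a` iff `s ⇝ a` in `D₀`. -/
lemma reach_iff_path {arcs : E → Finset (V × V)} {w v t : V} {T : Finset V} {c₁ c₂ : E}
    (hc₁ : arcs c₁ = {(w, v)}) (hc₂ : arcs c₂ = {(v, t)}) (htT : t ∈ T)
    (hpath : OnlyPathCoins arcs w v c₁ c₂) {s : V} {ω : Config E} (hR : ω ∈ avoidEvent arcs s T)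
    {a : V} (ha : a ∉ ({w, v} : Finset V) ∪ T) :
    Reach arcs ω s a ↔ Reach (arcsOff arcs ({w, v} ∪ T)) ω s a := by
  constructor
  · intro h
    rcases reach_split' ({w, v} ∪ T) h with h₀ | ⟨z, hz, hsz, hza⟩
    · exact h₀
    · rw [Finset.mem_union] at hz
      rcases hz with hz | hz
      · obtain ⟨t', ht', hzt⟩ := reach_from_path_into_T hc₁ hc₂ htT hpath hz ha hza
        exact absurd (reach_trans (reach_of_reach_arcsOff hsz) hzt) (hR t' ht')
      · exact absurd (reach_of_reach_arcsOff hsz) (hR z hz)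
  · exact reach_of_reach_arcsOff

/-- **Level 0** (`c₂` closed): `R_T` is the reduced `R_T`. -/
lemma avoid_level₀ {arcs : E → Finset (V × V)} {w v t : V} {T : Finset V} {c₁ c₂ : E}
    (hc₁ : arcs c₁ = {(w, v)}) (hc₂ : arcs c₂ = {(v, t)}) (hwv : w ≠ v) (htT : t ∈ T)
    (hwT : w ∉ T) (hvT : v ∉ T) (hpath : OnlyPathCoins arcs w v c₁ c₂) {s : V} {ω : Config E}
    (h₂ : ω c₂ = false) :
    ω ∈ avoidEvent arcs s T ↔ ω ∈ avoidEvent (arcsOff arcs ({w, v} ∪ T)) s T := by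
  constructor
  · intro hR t' ht' hr; exact hR t' ht' (reach_of_reach_arcsOff hr)
  · intro hR t' ht' hr
    rcases reach_split' ({w, v} ∪ T) hr with h₀ | ⟨z, hz, hsz, hzt⟩
    · exact hR t' ht' h₀
    · rw [Finset.mem_union] at hz
      rcases hz with hz | hz
      · simp only [Finset.mem_insert, Finset.mem_singleton] at hz
        rcases hz with rfl | rfl
        · have := (bwd_w_iff hc₁ hc₂ hwv htT hwT hvT hpath ω).mp ⟨t', ht', hzt⟩
          rw [h₂] at this; exact absurd this.2 (by decide)
        · have := (bwd_v_iff hc₁ hc₂ hwv htT hwT hvT hpath ω).mp ⟨t', ht', hzt⟩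
          rw [h₂] at this; exact absurd this (by decide)
      · exact hR z hz hsz

/-- **Level 1** (`c₂` open, `c₁` closed): `R_T` is the reduced `R_{T ∪ {v}}`. -/
lemma avoid_level₁ {arcs : E → Finset (V × V)} {w v t : V} {T : Finset V} {c₁ c₂ : E}
    (hc₁ : arcs c₁ = {(w, v)}) (hc₂ : arcs c₂ = {(v, t)}) (hwv : w ≠ v) (htT : t ∈ T)
    (hwT : w ∉ T) (hvT : v ∉ T) (hpath : OnlyPathCoins arcs w v c₁ c₂) {s : V} {ω : Config E}
    (h₁ : ω c₁ = false) (h₂ : ω c₂ = true) :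
    ω ∈ avoidEvent arcs s T ↔ ω ∈ avoidEvent (arcsOff arcs ({w, v} ∪ T)) s (insert v T) := by
  constructor
  · intro hR t' ht' hr
    simp only [Finset.mem_insert] at ht'
    rcases ht' with rfl | ht'
    · obtain ⟨t'', ht'', hvt⟩ := (bwd_v_iff hc₁ hc₂ hwv htT hwT hvT hpath ω).mpr h₂
      exact hR t'' ht'' (reach_trans (reach_of_reach_arcsOff hr) hvt)
    · exact hR t' ht' (reach_of_reach_arcsOff hr)
  · intro hR t' ht' hr
    rcases reach_split' ({w, v} ∪ T) hr with h₀ | ⟨z, hz, hsz, hzt⟩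
    · exact hR t' (Finset.mem_insert_of_mem ht') h₀
    · rw [Finset.mem_union] at hz
      rcases hz with hz | hz
      · simp only [Finset.mem_insert, Finset.mem_singleton] at hz
        rcases hz with rfl | rfl
        · have := (bwd_w_iff hc₁ hc₂ hwv htT hwT hvT hpath ω).mp ⟨t', ht', hzt⟩
          rw [h₁] at this; exact absurd this.1 (by decide)
        · exact hR _ (Finset.mem_insert_self _ _) hsz
      · exact hR z (Finset.mem_insert_of_mem hz) hsz

/-- **Level 2** (both open): `R_T` is the reduced `R_{T ∪ {v, w}}`. -/
lemma avoid_level₂ {arcs : E → Finset (V × V)} {w v t : V} {T : Finset V} {c₁ c₂ : E}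
    (hc₁ : arcs c₁ = {(w, v)}) (hc₂ : arcs c₂ = {(v, t)}) (hwv : w ≠ v) (htT : t ∈ T)
    (hwT : w ∉ T) (hvT : v ∉ T) (hpath : OnlyPathCoins arcs w v c₁ c₂) {s : V} {ω : Config E}
    (h₁ : ω c₁ = true) (h₂ : ω c₂ = true) :
    ω ∈ avoidEvent arcs s T ↔
      ω ∈ avoidEvent (arcsOff arcs ({w, v} ∪ T)) s (insert w (insert v T)) := by
  constructor
  · intro hR t' ht' hr
    simp only [Finset.mem_insert] at ht'
    rcases ht' with rfl | rfl | ht'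
    · obtain ⟨t'', ht'', hwt⟩ := (bwd_w_iff hc₁ hc₂ hwv htT hwT hvT hpath ω).mpr ⟨h₁, h₂⟩
      exact hR t'' ht'' (reach_trans (reach_of_reach_arcsOff hr) hwt)
    · obtain ⟨t'', ht'', hvt⟩ := (bwd_v_iff hc₁ hc₂ hwv htT hwT hvT hpath ω).mpr h₂
      exact hR t'' ht'' (reach_trans (reach_of_reach_arcsOff hr) hvt)
    · exact hR t' ht' (reach_of_reach_arcsOff hr)
  · intro hR t' ht' hr
    rcases reach_split' ({w, v} ∪ T) hr with h₀ | ⟨z, hz, hsz, _⟩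
    · exact hR t' (by simp [ht']) h₀
    · rw [Finset.mem_union] at hz
      rcases hz with hz | hz
      · simp only [Finset.mem_insert, Finset.mem_singleton] at hz
        rcases hz with rfl | rfl
        · exact hR _ (by simp) hsz
        · exact hR _ (by simp) hsz
      · exact hR z (by simp [hz]) hsz

omit [DecidableEq V] in
/-- **The gate on levels 0 and 1** is `R_T` (nothing is pivotal: `w ↛ T`). -/
lemma gate_eq_avoid_of_not_bwd {arcs : E → Finset (V × V)} {s u w : V} {T : Finset V}
    {ω : Config E} (hG : ω ∉ bwdEvent arcs w T) :
    ω ∈ gateEvent arcs s T u w ↔ ω ∈ avoidEvent arcs s T := by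
  rw [gateEvent_eq_union]
  simp only [Set.mem_inter_iff, Set.mem_union, Set.mem_compl_iff, hG, not_false_eq_true, or_true,
    and_true]

/-- **The gate on level 2** is the reduced `R_{T ∪ {u, w, v}}`. -/
lemma gate_level₂ {arcs : E → Finset (V × V)} {w v t : V} {T : Finset V} {c₁ c₂ : E}
    (hc₁ : arcs c₁ = {(w, v)}) (hc₂ : arcs c₂ = {(v, t)}) (hwv : w ≠ v) (htT : t ∈ T)
    (hwT : w ∉ T) (hvT : v ∉ T) (hpath : OnlyPathCoins arcs w v c₁ c₂) {s u : V} {ω : Config E}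
    (h₁ : ω c₁ = true) (h₂ : ω c₂ = true) :
    ω ∈ gateEvent arcs s T u w ↔
      ω ∈ avoidEvent (arcsOff arcs ({w, v} ∪ T)) s (insert u (insert w (insert v T))) := by
  have hG : ω ∈ bwdEvent arcs w T := (bwd_w_iff hc₁ hc₂ hwv htT hwT hvT hpath ω).mpr ⟨h₁, h₂⟩
  rw [gateEvent_eq_union]
  simp only [Set.mem_inter_iff, Set.mem_union, Set.mem_compl_iff, hG, not_true_eq_false, or_false]
  rw [avoid_level₂ hc₁ hc₂ hwv htT hwT hvT hpath h₁ h₂]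
  constructor
  · rintro ⟨hR, hu⟩ t' ht' hr
    simp only [Finset.mem_insert] at ht'
    rcases ht' with rfl | ht'
    · exact hu (reach_of_reach_arcsOff hr)
    · exact hR t' (by simpa using ht') hr
  · intro h
    refine ⟨fun t' ht' hr => h t' (Finset.mem_insert_of_mem ht') hr, fun hsu => ?_⟩
    rcases reach_split' ({w, v} ∪ T) hsu with h₀ | ⟨z, hz, hsz, _⟩
    · exact h u (Finset.mem_insert_self _ _) h₀
    · rw [Finset.mem_union] at hz
      rcases hz with hz | hz
      · simp only [Finset.mem_insert, Finset.mem_singleton] at hz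
        rcases hz with rfl | rfl
        · exact h _ (by simp) hsz
        · exact h _ (by simp) hsz
      · exact h z (by simp [hz]) hsz

end Path

end Summit.Ventures.PercRepro2.Coin
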